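import Summits.BirchSwinnertonDyer.BirchSwinnertonDyer.Theorems.RamifiedSevenEllipticUnitsStrictTorsionOfGZKAnyPrime
import Summits.BirchSwinnertonDyer.Rank1Residual.X12.CMNoPrimeTorsion
import Summits.BirchSwinnertonDyer.Rank1Residual.X11b.KolyvaginHGZOfKodairaNeronRat
import Literature.NumberTheory.DiophantineGeometry.KodairaSymbolUnramifiedBaseChangeProofs
import Literature.NumberTheory.EllipticCurves.HasseWeilGoodReductionFrobenius
import Literature.NumberTheory.EllipticCurves.TamagawaPrimesEquivProofs
import Literature.NumberTheory.EllipticCurves.MazurTorsionLocalStepsProofs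
import HarnessLib

set_option linter.dupNamespace false

/-!
# Route `RamifiedSevenEllipticUnits` (rung K7r), crux `StrictControlSeven` (stmt-BirchSwinnertonDyer-19145):
# the typed object (R-ctrl) `X12.O11.RamifiedCMStrictControlAt W p` is a THEOREM at EVERY prime —
# both local no-`p`-torsion inputs discharged at every O11 frame

Cell `bsd-cm`, seat `bsd-cm-k7r-c4` (g4). HONEST FRAMING: crux #4 `StrictControlSeven` (= the case
`p = 7`, class 𝒞₇) is already closed (g0, `StrictControlSeven_proof`); nothing here closes a further
item and BSD is not proved by any of this; a closed item closes a rung leaf of BirchSwinnertonDyer at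
most. This file is frame-level content of the crux's typed object BEYOND 𝒞₇ / the prime `7`: the O11
corner (CM, analytic rank one, `p = |d_K| ≥ 5` ramified in the CM field `K`; `p ∈ {7, 11, 19, 43, 67,
163}`) has census cells at every such `p`, and the seat's g0 chain for (R-ctrl) is `p`-generic except
for its two LOCAL inputs, which are discharged here for every frame:

* (A𝔭) `W_K(K_𝔭)[p] = 0` at the ramified prime: `E(ℚ_p)[p] = 0` for `W` and for the frame twin
  `W' ≅ W^{(−p)}` by Mazur's local step at the ADDITIVE prime `p` (at `p = 7` the exceptional locus
  `v₇(c₆) = 1` is empty on CM curves, `seven_nsmul_eq_zero_padic`; at `p ≥ 11` there is none,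
  `Additive.eq_zero_of_prime_nsmul_eq_zero_of_addv_of_eleven_le`), then quadratic descent of
  `p`-primary torsion along `K_𝔭 = ℚ_p(√−p)` as in g0's `noSevenTorsion_adicCompletion_of_classCSeven`.
* (Av) at every finite `v ∤ p` of `K`: good reduction of `W_K` at `v`, or `W_K(K_v)[p] = 0` — UNIFORM
  in the splitting type of the prime `ℓ` under `v` (no class clause): `ℓ ≠ p` is prime to
  `d_K = −p`, so `e(v | ℓ) = 1` and the additive type of a bad `ℓ` (CM) ascends to `v` (tree THEOREM
  A233 `kodairaSymbolAt_baseChange_of_ramificationIdx_eq_one_holds`, Silverman *AEC* VII.5.4 (a));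
  Mazur's Step 1 over the DVR `𝒪_v` (`eq_zero_of_hasAdditiveReduction_of_prime_nsmul_eq_zero`,
  residue characteristic `ℓ ≠ p`) kills the `p`-torsion. (g0's `good_or_noSevenTorsion_of_classCSeven`
  needed the 𝒞₇ clause "bad `ℓ ≠ 7` split in `K`"; the inert case is new here.)

## Main statements (every `W/ℚ` globally minimal, every prime `p`; an O11 frame forces `p ≥ 7`)

* `prime_nsmul_eq_zero_padic_of_hasCM_of_cmRamified` (`E(ℚ_p)[p] = 0`), `not_sq_eq_neg_prime_padic`,
  `noPTorsion_adicCompletion_of_isFrame` (A𝔭), `good_or_noPTorsion_of_isFrame` (Av);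
* **`ramifiedCMStrictControlAt_holds : X12.O11.RamifiedCMStrictControlAt W p`** — O11's typed input
  (R-ctrl) holds outright (exact control from (A𝔭)/(Av) + k7r-c3 g4's unconditional twist-descent
  count `natCard_selmerAcBase_frame_eq_mul_prime`; `ord_p` of a non-zero product is additive);
* `ramifiedCMStrictTorsionAt_of_GZK` — (R-tors) at every prime from GZK alone (k7r-c3 g4's
  `ramifiedCMStrictTorsionAt_of_GZK_of_noPTorsion` fed with (A𝔭)/(Av));
* `bsdp_of_ramifiedCMEllipticUnitIndexAt` — `X12.O11.bsdp_of_halves` with (R-tors)/(R-ctrl)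
  discharged: at an analytic-rank-one frame `BSD(W, p)` ⟸ (R-EU)@`p` + {modularity, GZ I.7.3, GZK,
  Cassels}; at every ramified `p` the corner's ONE residual input is the elliptic-unit index law
  (R-EU) (Perrin-Riou's conjecture for the CM zeta element; BKNO 2026 §1.4), CONSTRUCTION / OPEN.
No Euler system, no `Λ`-module structure theory, no elliptic unit is used; no named fact is minted.
References: [Mazur1977] III.5 Step 1; [SilvermanAEC2009] VII.5.4 (a), Ex. 10.16; [SilvermanATAEC1994]
IV.9.2(d), App. A §3; [GreenbergLNM1716] §3–§4; [Castella2018] Def. 2.2; [DokchitserDokchitserAnnals2010]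
Lemma 4.14; [BurungaleKobayashiNakamuraOta2026] (3.16), §1.4 (arXiv:2608.06879; shape only, nothing used).
-/

noncomputable section

open scoped Classical

open WeierstrassCurve NumberField IsDedekindDomain Field
  Literature.NumberTheory.EllipticCurves
  Literature.NumberTheory.EllipticCurves.Rank1Residual
  Literature.NumberTheory.GaloisRepresentations
  Literature.NumberTheory.DiophantineGeometry
  Summit.BirchSwinnertonDyer.Rank1Residual
  Summit.BirchSwinnertonDyer.Rank1Residual.Additive
  Summit.BirchSwinnertonDyer.Rank1Residual.X11b
  Summit.BirchSwinnertonDyer.Rank1Residual.X11b.AcSelmer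

namespace Summit.BirchSwinnertonDyer.BirchSwinnertonDyer.Theorems.RamifiedSevenEllipticUnits

/-! ## §1 `E(ℚ_p)[p] = 0` at a CM-ramified prime `p ≥ 5` -/

/-- **`E(ℚ_p)[p] = 0` for a globally minimal CM curve `E/ℚ` at a CM-ramified prime `p ≥ 5`.** Then
`p ∈ {7, 11, 19, 43, 67, 163}` and `d_K = −p` (`X12.eq_of_dvd_cmFieldDiscrOfJ`); `p` is ADDITIVE for
`E` (`X12.addv_of_hasCM_of_cmRamified`), and Mazur's local step applies: at `p = 7` the exceptional
locus `v₇(c₆) = 1` is empty on CM curves (`seven_nsmul_eq_zero_padic`), at `p ≥ 11` there is none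
(`Additive.eq_zero_of_prime_nsmul_eq_zero_of_addv_of_eleven_le`).
[cite: Mazur1977, Ch. III §5, Step 1, p. 158] [cite: SilvermanATAEC1994, App. A §3 (table of CM j-invariants)] -/
theorem prime_nsmul_eq_zero_padic_of_hasCM_of_cmRamified (W : WeierstrassCurve ℚ) [W.IsElliptic]
    [W.IsGloballyMinimal] (p : ℕ) [Fact p.Prime] (hCM : W.HasCM) (h5 : 5 ≤ p)
    (hram : CMRamified W p) :
    ∀ Q : (W.baseChange ℚ_[p]).toAffine.Point, p • Q = 0 → Q = 0 := by
  intro Q hQ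
  have hp : p.Prime := Fact.out
  obtain ⟨hcases, hd⟩ := X12.eq_of_dvd_cmFieldDiscrOfJ W hCM hp h5 hram
  rcases hcases with rfl | h11
  · exact seven_nsmul_eq_zero_padic W hCM (by rw [hd]; norm_num) Q hQ
  · have h11' : 11 ≤ p := by rcases h11 with rfl | rfl | rfl | rfl | rfl <;> norm_num
    have hadd : Addv W p := X12.addv_of_hasCM_of_cmRamified W p hCM (by omega) hram
    exact Additive.eq_zero_of_prime_nsmul_eq_zero_of_addv_of_eleven_le W p h11' hadd hQ

/-! ## §2 `√−p ∉ ℚ_p` -/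

/-- **`−p` is not a square in `ℚ_p`**: `‖y‖² = ‖−p‖ = p⁻¹` forces `p^{−2v(y)} = p^{−1}`, impossible
by parity. [folklore] -/
theorem not_sq_eq_neg_prime_padic (p : ℕ) [Fact p.Prime] (y : ℚ_[p]) : y ^ 2 ≠ -(p : ℚ_[p]) := by
  have hp : p.Prime := Fact.out
  intro h
  have hy0 : y ≠ 0 := by
    rintro rfl
    have h0 : (p : ℚ_[p]) = 0 := by
      have : (0 : ℚ_[p]) ^ 2 = 0 := by ring
      rw [this] at h
      exact neg_eq_zero.mp h.symm
    exact (Nat.cast_ne_zero.mpr hp.ne_zero) h0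
  have h1 : ‖y‖ ^ 2 = (p : ℝ)⁻¹ := by
    rw [← norm_pow, h, norm_neg, Padic.norm_p]
  rw [Padic.norm_eq_zpow_neg_valuation hy0, ← zpow_natCast, ← zpow_mul, ← zpow_neg_one] at h1
  have hp0 : (0 : ℝ) < (p : ℝ) := by exact_mod_cast hp.pos
  have hp1 : (p : ℝ) ≠ 1 := by exact_mod_cast hp.one_lt.ne'
  have hinj := zpow_right_injective₀ (G₀ := ℝ) (a := (p : ℝ)) hp0 hp1 h1
  omega

/-! ## §3 (A𝔭): `E(K_𝔭)[p] = 0` at every O11 frame -/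

/-- **(A𝔭) `W_K(K_𝔭)[p] = 0` at every O11 frame**, every prime (`K` the CM field, `d_K = −p`, `𝔭 ∋ p`
ramified, `W' = C • W^{(−p)}` the globally minimal frame twin): quadratic descent of `p`-primary torsion
along `K_𝔭 = ℚ_p(√−p)` (`[K_𝔭 : ℚ_p] = 2` as `−p ∉ ℚ_p²`; Silverman *AEC* Ex. 10.16, tree
`card_primaryComponent_point_baseChange_quadratic_of_odd'`) to `W(ℚ_p)[p^∞]` and `W'(ℚ_p)[p^∞]`, both
trivial by §1 (`W' ∼ W` has CM with the same `d_K`). BKNO's (3.16) at the bottom layer as a theorem at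
every frame; g0's `noSevenTorsion_adicCompletion_of_classCSeven` is the case `p = 7`.
[cite: SilvermanAEC2009, Exercise 10.16] [cite: Mazur1977, Ch. III §5 Step 1 (p. 158)] [cite: BurungaleKobayashiNakamuraOta2026, (3.16) (arXiv:2608.06879; statement proved here)] -/
theorem noPTorsion_adicCompletion_of_isFrame (W : WeierstrassCurve ℚ) [W.IsElliptic]
    [W.IsGloballyMinimal] (p : ℕ) [Fact p.Prime]
    {K : Type} [Field K] [NumberField K] {𝔭 : HeightOneSpectrum (𝓞 K)}
    {W' : WeierstrassCurve ℚ} [W'.IsElliptic] [W'.IsGloballyMinimal] {C : VariableChange ℚ}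
    (hF : X12.O11.IsFrame W p K 𝔭 W' C) :
    ∀ R : ((W.baseChange K).baseChange (𝔭.adicCompletion K)).toAffine.Point, p • R = 0 → R = 0 := by
  have hp : p.Prime := Fact.out
  have hCM : W.HasCM := hF.1
  have hram : CMRamified W p := hF.2.1
  have h5 : 5 ≤ p := hF.2.2.1
  have hK : IsImaginaryQuadratic K := hF.2.2.2.1
  have hdisc : NumberField.discr K = cmFieldDiscrOfJ W.j := hF.2.2.2.2.1
  have h𝔭 : ((p : ℕ) : 𝓞 K) ∈ 𝔭.asIdeal := hF.2.2.2.2.2.1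
  have hW' : C • W.quadraticTwist ((cmFieldDiscrOfJ W.j : ℤ) : ℚ) = W' := hF.2.2.2.2.2.2
  have hd : cmFieldDiscrOfJ W.j = -(p : ℤ) := X12.cmFieldDiscrOfJ_eq_neg_of_dvd W hCM hp h5 hram
  have hp2 : p ≠ 2 := by omega
  -- no `p`-torsion over `ℚ_p` for `W` and for the twin `W'`
  have hiso : IsIsogenous W W' := isIsogenous_of_isFrame hF
  have hCM' : W'.HasCM := X12.hasCM_of_isIsogenous hiso hCM
  have hram' : CMRamified W' p := by
    change (p : ℤ) ∣ cmFieldDiscrOfJ W'.j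
    rw [← X12.cmFieldDiscrOfJ_eq_of_isIsogenous hiso hCM]
    exact hram
  have hpW := prime_nsmul_eq_zero_padic_of_hasCM_of_cmRamified W p hCM h5 hram
  have hpW' := prime_nsmul_eq_zero_padic_of_hasCM_of_cmRamified W' p hCM' h5 hram'
  -- the local fields `F = ℚ_v(p)` and `L = K_𝔭`
  haveI : 𝔭.asIdeal.LiesOver (ratPlace p).asIdeal := ⟨by rw [← under_eq_ratPlace_of_mem h𝔭]; rfl⟩
  set F : Type := (ratPlace p).adicCompletion ℚ with hFdef
  set L : Type := 𝔭.adicCompletion K with hLdef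
  haveI : CharZero F := charZero_of_injective_algebraMap (algebraMap ℚ F).injective
  haveI : CharZero L := charZero_of_injective_algebraMap (algebraMap K L).injective
  letI : Algebra F L := (adicCompletionMap (K := ℚ) K (ratPlace p) 𝔭).toAlgebra
  obtain ⟨hfin, hle⟩ := finrank_adicCompletion_le_of_liesOver (K := ℚ) K (ratPlace p) 𝔭
  haveI : FiniteDimensional F L := hfin
  rw [hK.1] at hle
  -- `F ≃ ℚ_p` and the transports of "no `p`-torsion" to `F`
  let e : F →+* ℚ_[p] :=
    (Padic.adicCompletionEquiv (𝓞 ℚ) ⟨p, hp⟩).symm.toAlgEquiv.toRingEquiv.toRingHom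
  have hpF : ∀ R : (W.baseChange F).toAffine.Point, p • R = 0 → R = 0 :=
    noPTorsion_baseChange_of_algHom W p e.toRatAlgHom hpW
  have hpF' : ∀ R : (W'.baseChange F).toAffine.Point, p • R = 0 → R = 0 :=
    noPTorsion_baseChange_of_algHom W' p e.toRatAlgHom hpW'
  -- `√−p ∈ L`, not in `F`
  obtain ⟨θ₁, -, hθ₁sq⟩ := exists_sq_eq_discr_not_mem_range K hK.1
  rw [hdisc, hd] at hθ₁sq
  simp only [Int.cast_neg, Int.cast_natCast, map_neg, map_natCast] at hθ₁sq
  set θ : L := algebraMap K L θ₁ with hθdef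
  have hθsq : θ ^ 2 = algebraMap F L (-(p : F)) := by
    rw [map_neg, map_natCast, hθdef, ← map_pow, hθ₁sq, map_neg, map_natCast]
  have hθ : θ ∉ Set.range (algebraMap F L) := by
    rintro ⟨x, hx⟩
    have hx2 : x ^ 2 = -(p : F) :=
      (algebraMap F L).injective (by rw [map_pow, hx, hθsq, map_neg, map_natCast])
    apply not_sq_eq_neg_prime_padic p (e x)
    rw [← map_pow, hx2, map_neg, map_natCast]
  -- `[L : F] = 2`
  have h2 : Module.finrank F L = 2 := by
    have hle' : Module.finrank F L ≤ 2 := hle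
    have hpos : 0 < Module.finrank F L := Module.finrank_pos
    have hne1 : Module.finrank F L ≠ 1 := by
      intro h1
      have hbot : (⊥ : Subalgebra F L) = ⊤ := Subalgebra.bot_eq_top_iff_finrank_eq_one.mpr h1
      apply hθ
      have hmem : θ ∈ (⊥ : Subalgebra F L) := by rw [hbot]; exact Algebra.mem_top
      rwa [Algebra.mem_bot] at hmem
    omega
  -- the quadratic descent of `p`-primary torsion: `#E(L)[p^∞] = #W(F)[p^∞] · #W'(F)[p^∞]`
  have hWd : ∃ D : VariableChange F,
      D • (W.baseChange F).quadraticTwist (-(p : F)) = W'.baseChange F := by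
    refine ⟨C.map (algebraMap ℚ F), ?_⟩
    rw [hd] at hW'
    simp only [Int.cast_neg, Int.cast_natCast] at hW'
    have hpF0 : (-(p : F)) = algebraMap ℚ F (-(p : ℚ)) := by rw [map_neg, map_natCast]
    rw [hpF0, baseChange, baseChange, ← map_quadraticTwist, map_variableChange, hW']
  have hKL : (W.baseChange K).baseChange L = W.baseChange L :=
    W.map_baseChange (algebraMap K L).toRatAlgHom
  have hFL : (W.baseChange F).baseChange L = W.baseChange L :=
    W.map_baseChange (algebraMap F L).toRatAlgHom
  have hmodel : ∃ D : VariableChange L,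
      D • (W.baseChange F).baseChange L = (W.baseChange K).baseChange L :=
    ⟨1, by rw [one_smul, hFL, hKL]⟩
  have key := card_primaryComponent_point_baseChange_quadratic_of_odd' (W.baseChange F) h2 hθ hθsq
    hWd hmodel p hp2
  rw [(natCard_primaryComponent_eq_one_iff p).mpr hpF,
    (natCard_primaryComponent_eq_one_iff p).mpr hpF', mul_one] at key
  exact (natCard_primaryComponent_eq_one_iff p).mp key

/-! ## §4 (Av): good reduction or no `p`-torsion at every `v ∤ p`, uniformly in the splitting type -/

/-- **(Av) at every O11 frame, every prime.** For `W/ℚ` with an O11 frame `(K, 𝔭, W', C)` at `p` and a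
finite place `v ∤ p` of the CM field `K`: `W_K` has good reduction at `v`, or `W_K(K_v)[p] = 0`. At the
prime `ℓ` under `v`: good reduction ascends (`hasGoodReductionAt_baseChange_of_hasGoodReductionAt_rat`);
otherwise `ℓ` is additive for the CM curve `W` (`not_mult_of_hasCM`), `ℓ ≠ p` is prime to `d_K = −p`
so `e(v | ℓ) = 1` and the ADDITIVE type ascends to `v` (tree theorem A233
`kodairaSymbolAt_baseChange_of_ramificationIdx_eq_one_holds`, Silverman *AEC* VII.5.4 (a)); Mazur's
Step 1 over the DVR `𝒪_v` (residue characteristic `ℓ ≠ p`, `p ≥ 5`) on the `𝒪_v`-minimal model,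
transported to the given equation. No splitting condition on `ℓ` (g0's 𝒞₇ version used "split").
[cite: SilvermanAEC2009, Prop. VII.5.4 (a) with proof] [cite: Mazur1977, Ch. III §5 Step 1 (p. 158)] [cite: SilvermanATAEC1994, Cor. IV.9.2(d)] -/
theorem good_or_noPTorsion_of_isFrame (W : WeierstrassCurve ℚ) [W.IsElliptic] (p : ℕ) [Fact p.Prime]
    {K : Type} [Field K] [NumberField K] {𝔭 : HeightOneSpectrum (𝓞 K)}
    {W' : WeierstrassCurve ℚ} {C : VariableChange ℚ} (hF : X12.O11.IsFrame W p K 𝔭 W' C)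
    (v : HeightOneSpectrum (𝓞 K)) (hpv : ((p : ℕ) : 𝓞 K) ∉ v.asIdeal) :
    (W.baseChange K).HasGoodReductionAt v ∨
      ∀ R : ((W.baseChange K).baseChange (v.adicCompletion K)).toAffine.Point,
        p • R = 0 → R = 0 := by
  have hp : p.Prime := Fact.out
  have hCM : W.HasCM := hF.1
  have hram : CMRamified W p := hF.2.1
  have h5 : 5 ≤ p := hF.2.2.1
  have hdisc : NumberField.discr K = cmFieldDiscrOfJ W.j := hF.2.2.2.2.1
  have hd : cmFieldDiscrOfJ W.j = -(p : ℤ) := X12.cmFieldDiscrOfJ_eq_neg_of_dvd W hCM hp h5 hram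
  -- the rational prime `ℓ` under `v`
  set v₀ : HeightOneSpectrum (𝓞 ℚ) := v.under (𝓞 ℚ) with hv₀def
  set ℓ : ℕ := (Rat.HeightOneSpectrum.primesEquiv v₀ : ℕ) with hℓdef
  haveI hℓ : Fact ℓ.Prime := ⟨(Rat.HeightOneSpectrum.primesEquiv v₀).2⟩
  have hv₀ : v.under (𝓞 ℚ) = ratPlace ℓ := by
    rw [ratPlace, ← hv₀def]
    exact ((Rat.HeightOneSpectrum.primesEquiv (R := 𝓞 ℚ)).symm_apply_apply v₀).symm
  have hℓv : ((ℓ : ℕ) : 𝓞 K) ∈ v.asIdeal := mem_of_under_eq_ratPlace hv₀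
  haveI : v.asIdeal.LiesOver v₀.asIdeal := ⟨rfl⟩
  have hℓp : ℓ ≠ p := by
    intro h
    rw [h] at hℓv
    exact hpv hℓv
  by_cases hgood : Good W ℓ
  · -- good reduction base-changes to `K` at `v`
    left
    have hgood' : W.HasGoodReductionAt v₀ :=
      (hasGoodReductionAtPrime_primesEquiv_iff_holds W v₀ ℓ rfl).mp hgood
    exact hasGoodReductionAt_baseChange_of_hasGoodReductionAt_rat W v₀ v hgood'
  · right
    -- `ℓ` is additive for the CM curve `W`: at the place `v₀` of `ℚ`
    have hmult : ¬ Mult W ℓ := not_mult_of_hasCM W hCM ℓ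
    have hng : ¬ W.HasGoodReductionAt v₀ := fun h ↦
      hgood ((hasGoodReductionAtPrime_primesEquiv_iff_holds W v₀ ℓ rfl).mpr h)
    have hnm : ¬ W.HasMultiplicativeReductionAt v₀ := fun h ↦
      hmult ((hasMultiplicativeReductionAtPrime_primesEquiv_iff_holds W v₀ ℓ rfl).mpr h)
    have hadd : W.HasAdditiveReductionAt v₀ := by
      rcases hasGoodReduction_or_hasMultiplicativeReduction_or_hasAdditiveReduction
          (v₀.adicCompletionIntegers ℚ) (W := W.localMinimalModel v₀) with h | h | h
      · exact absurd (show W.HasGoodReductionAt v₀ from h) hng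
      · exact absurd (show W.HasMultiplicativeReductionAt v₀ from h) hnm
      · exact h
    -- `ℓ ∤ d_K = −p`, so `e(v | ℓ) = 1` and the additive type ascends to `v`
    have hℓd : ¬ ((Rat.HeightOneSpectrum.primesEquiv v₀ : ℕ) : ℤ) ∣ NumberField.discr K := by
      rw [hdisc, hd, ← hℓdef, dvd_neg, Int.natCast_dvd_natCast]
      exact fun h ↦ hℓp ((Nat.prime_dvd_prime_iff_eq hℓ.out hp).mp h)
    have he : v.asIdeal.ramificationIdx (𝓞 ℚ) = 1 :=
      KolyvaginHloc.ramificationIdx_eq_one_of_not_dvd_discr v₀ v hℓd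
    haveI : PerfectField (IsLocalRing.ResidueField (v₀.adicCompletionIntegers ℚ)) :=
      PerfectField.ofFinite
    haveI : Finite (IsLocalRing.ResidueField (v.adicCompletionIntegers K)) :=
      HeightOneSpectrum.finite_residueField_adicCompletionIntegers K v
    haveI : PerfectField (IsLocalRing.ResidueField (v.adicCompletionIntegers K)) :=
      PerfectField.ofFinite
    have hc : (algebraMap ℚ K).comp (algebraMap (𝓞 ℚ) ℚ) =
        (algebraMap (𝓞 K) K).comp (algebraMap (𝓞 ℚ) (𝓞 K)) := by
      rw [← IsScalarTower.algebraMap_eq, ← IsScalarTower.algebraMap_eq]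
    have hwv : v.asIdeal.under (𝓞 ℚ) = v₀.asIdeal := rfl
    have haddK : (W.baseChange K).HasAdditiveReductionAt v :=
      hasAdditiveReductionAt_baseChange_of_ramificationIdx_eq_one
        (UnramifiedBaseChange.kodairaSymbolAt_baseChange_of_ramificationIdx_eq_one_holds K v₀ v W)
        hc hwv (KolyvaginHloc.not_map_le_sq_of_ramificationIdx_eq_one' hwv he) hadd
    -- Mazur's Step 1 on the `𝒪_v`-minimal model of `W_K ⊗ K_v`, transported to the given equation
    have hmin : (((W.baseChange K).baseChange (v.adicCompletion K)).minimal
        (v.adicCompletionIntegers K)).HasAdditiveReduction (v.adicCompletionIntegers K) := haddK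
    haveI := hmin
    haveI : (((W.baseChange K).baseChange (v.adicCompletion K)).minimal
        (v.adicCompletionIntegers K)).IsElliptic := by
      unfold minimal baseChange; infer_instance
    have hpk : (p : IsLocalRing.ResidueField (v.adicCompletionIntegers K)) ≠ 0 :=
      WeierstrassCurve.natCast_residueField_ne_zero hpv
    have hX : ∀ P : (((W.baseChange K).baseChange (v.adicCompletion K)).minimal
        (v.adicCompletionIntegers K)).toAffine.Point, p • P = 0 → P = 0 :=
      fun P hP ↦ eq_zero_of_hasAdditiveReduction_of_prime_nsmul_eq_zero
        (v.adicCompletionIntegers K) _ hp h5 hpk hP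
    obtain ⟨D, hD⟩ : ∃ D : VariableChange (v.adicCompletion K),
        ((W.baseChange K).baseChange (v.adicCompletion K)).minimal (v.adicCompletionIntegers K) =
          D • (W.baseChange K).baseChange (v.adicCompletion K) := ⟨_, rfl⟩
    rw [hD] at hX
    intro R hR
    have h := hX (VariableChange.pointEquiv ((W.baseChange K).baseChange (v.adicCompletion K)) D R)
      (by rw [← map_nsmul, hR, map_zero])
    exact (AddEquiv.map_eq_zero_iff _).mp h

/-! ## §5 (R-ctrl) at every prime, unconditionally -/

/-- **O11's typed input (R-ctrl) is a THEOREM at every frame: `X12.O11.RamifiedCMStrictControlAt W p`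
for every globally minimal elliptic `W/ℚ` and every prime `p`** (frames exist iff `W` has CM with
`d_K = −p`, `p ≥ 7`). EXACT bottom-layer control `#H⁰(Γ, Sel_𝔭(K_∞, E[p^∞])) = #Sel_𝔭(K, E[p^∞])`
from the two local inputs (A𝔭)/(Av) now discharged (`strictControl_frame_natCard_eq`, Greenberg §3),
the Euler-characteristic form of the item (`ramifiedCMStrictControlAt_iff_card`, Greenberg Lemma 4.2),
and the unconditional count `#Sel_𝔭(K, E[p^∞]) = #Sel_str(E/ℚ)[p^∞] · #Sel_str(E'/ℚ)[p^∞]` (k7r-c3 g4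
`natCard_selmerAcBase_frame_eq_mul_prime`). The crux `StrictControlSeven` (g0) is the case `p = 7` on
𝒞₇. No class hypothesis, no named fact.
[cite: GreenbergLNM1716, §3 Thm. 1.2 and §4 Lemma 4.2 (p. 102)] [cite: Castella2018, Def. 2.2 and Thm. 2.3 (arXiv:1704.06608 p. 5) (shape)] [cite: DokchitserDokchitserAnnals2010, Lemma 4.14 (proof)] -/
theorem ramifiedCMStrictControlAt_holds (W : WeierstrassCurve ℚ) [W.IsElliptic] [W.IsGloballyMinimal]
    (p : ℕ) [Fact p.Prime] : X12.O11.RamifiedCMStrictControlAt W p := by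
  rw [ramifiedCMStrictControlAt_iff_card]
  intro K _ _ 𝔭 W' _ _ C hF _ κ _ γ _ P n P' n' _ _ _ _ _ _ _ _ _ _ hfin
  have h𝔭 := noPTorsion_adicCompletion_of_isFrame W p hF
  have hv := good_or_noPTorsion_of_isFrame W p hF
  haveI : IsTotallyComplex K := hF.2.2.2.1.2
  haveI : (W.baseChange K).IsElliptic := by rw [baseChange]; infer_instance
  have hfin' : Finite (selmerAcBase (W.baseChange K) p 𝔭 ∅) :=
    (finite_endInvariants_iff_finite_selmerAcBase_of_noPTorsion (W.baseChange K) p κ 𝔭 γ h𝔭 hv).mp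
      hfin
  have hcount := natCard_selmerAcBase_frame_eq_mul_prime W p K 𝔭 W' C hF
  have hne : Nat.card ↥(strictSelmerPInfty W p) * Nat.card ↥(strictSelmerPInfty W' p) ≠ 0 := by
    rw [← hcount]
    haveI := hfin'
    exact Nat.card_pos.ne'
  rw [strictControl_frame_natCard_eq hF κ γ h𝔭 hv, hcount]
  exact padicValNat.mul (left_ne_zero_of_mul hne) (right_ne_zero_of_mul hne)

/- Consistency check at `p = 7` (an `example`, not a declaration): the closed route item
`StrictControlSeven` (g0 `StrictControlSeven_proof`) is the special case `p = 7`, class 𝒞₇. -/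
example :
    Summit.BirchSwinnertonDyer.BirchSwinnertonDyer.Theses.RamifiedSevenEllipticUnits.StrictControlSeven :=
  fun W _ _ _ _ ↦ ramifiedCMStrictControlAt_holds W 7

/-! ## §6 Consequences for the O11 corner at every ramified prime -/

/-- **(R-tors) at every prime from Gross–Zagier–Kolyvagin alone**: `X12.O11.RamifiedCMStrictTorsionAt W p`
for every globally minimal `W/ℚ` and every prime `p`, CONDITIONAL on the one named fact GZK
(`rank_eq_analyticRank_of_analyticRank_le_one`, hypothesis `hGZK`): k7r-c3 g4's
`ramifiedCMStrictTorsionAt_of_GZK_of_noPTorsion` with its two displayed local inputs discharged by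
(A𝔭) `noPTorsion_adicCompletion_of_isFrame` and (Av) `good_or_noPTorsion_of_isFrame`.
[cite: Kolyvagin1990, Thm. A] [cite: GreenbergLNM1716, §1 p. 61, §3 Lemmas 3.1–3.3 and §4 Lemma 4.2] -/
theorem ramifiedCMStrictTorsionAt_of_GZK (hGZK : rank_eq_analyticRank_of_analyticRank_le_one)
    (W : WeierstrassCurve ℚ) [W.IsElliptic] [W.IsGloballyMinimal] (p : ℕ) [Fact p.Prime] :
    X12.O11.RamifiedCMStrictTorsionAt W p :=
  ramifiedCMStrictTorsionAt_of_GZK_of_noPTorsion hGZK W p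
    (fun _ _ _ _ _ _ _ _ hF ↦ noPTorsion_adicCompletion_of_isFrame W p hF)
    (fun _ _ _ _ _ _ _ _ hF ↦ good_or_noPTorsion_of_isFrame W p hF)

/-- **The O11 consumer with (R-tors) and (R-ctrl) discharged: `BSD(W, p)` at an analytic-rank-one O11
frame from (R-EU)@`p` alone + four named facts** — `X12.O11.bsdp_of_halves` with
`h1 := ramifiedCMStrictTorsionAt_of_GZK hGZK W p` and `h2 := ramifiedCMStrictControlAt_holds W p`; the
frame data (`W ∼ W'`, `r_an(W) = 1`, anticyclotomic `κ` with topological generator `γ`, generators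
`P`, `P'` modulo torsion with their `p`-divisibility levels, `E(ℚ_p)[p] = 0`) and the named facts
modularity (`hmod`), Gross–Zagier I.(7.3) (`hGZ`), GZK (`hGZK`), Cassels (`hCassels`) are displayed.
So at every CM-ramified prime the corner's residual input is (R-EU) — Perrin-Riou's conjecture for the
CM zeta element at `p = |d_K|` (BKNO 2026 §1.4), CONSTRUCTION / OPEN; nothing is asserted about it.
[cite: BurungaleKobayashiNakamuraOta2026, Thm. 7.2 and §1.4 (arXiv:2608.06879 pp. 8, 40) (claim; preprint; shape only)] [cite: Cassels1965ArithmeticVIII] [cite: GrossZagier1986, Thm. I.(7.3)] [cite: Miller2011LMS, Def. 1.1] -/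
theorem bsdp_of_ramifiedCMEllipticUnitIndexAt (hmod : hasEntireLFunction_rat)
    (hGZ : GrossZagier1986_thm_I_7_3) (hGZK : rank_eq_analyticRank_of_analyticRank_le_one)
    (hCassels : bsdRHS_eq_of_isIsogenous)
    {W : WeierstrassCurve ℚ} [W.IsElliptic] [W.IsGloballyMinimal] {p : ℕ} [Fact p.Prime]
    (h3 : X12.O11.RamifiedCMEllipticUnitIndexAt W p)
    {K : Type} [Field K] [NumberField K] {𝔭 : HeightOneSpectrum (𝓞 K)}
    {W' : WeierstrassCurve ℚ} [W'.IsElliptic] [W'.IsGloballyMinimal] {C : VariableChange ℚ}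
    {κ : ZpExtension K p} {P : W.toAffine.Point} {n : ℕ} {P' : W'.toAffine.Point} {n' : ℕ}
    (hF : X12.O11.IsFrame W p K 𝔭 W' C) (hr : W.analyticRank = 1)
    (hκ : κ.IsAnticyclotomic) (γ : absoluteGaloisGroup K) [Fact (κ.IsTopGenerator γ)]
    (hP : ¬ IsOfFinAddOrder P)
    (hgen : ∀ R : W.toAffine.Point, ∃ (k : ℤ) (T : W.toAffine.Point),
      IsOfFinAddOrder T ∧ R = k • P + T)
    (htors : ∀ Q : (W.baseChange ℚ_[p]).toAffine.Point, p • Q = 0 → Q = 0)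
    (hdiv : ∃ Q : (W.baseChange ℚ_[p]).toAffine.Point, p ^ n • Q = W.toPadicPoint p P)
    (hndiv : ∀ Q : (W.baseChange ℚ_[p]).toAffine.Point, p ^ (n + 1) • Q ≠ W.toPadicPoint p P)
    (hP' : ¬ IsOfFinAddOrder P')
    (hgen' : ∀ R : W'.toAffine.Point, ∃ (k : ℤ) (T : W'.toAffine.Point),
      IsOfFinAddOrder T ∧ R = k • P' + T)
    (htors' : ∀ Q : (W'.baseChange ℚ_[p]).toAffine.Point, p • Q = 0 → Q = 0)
    (hdiv' : ∃ Q : (W'.baseChange ℚ_[p]).toAffine.Point, p ^ n' • Q = W'.toPadicPoint p P')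
    (hndiv' : ∀ Q : (W'.baseChange ℚ_[p]).toAffine.Point, p ^ (n' + 1) • Q ≠ W'.toPadicPoint p P') :
    BSDp W p :=
  X12.O11.bsdp_of_halves hmod hGZ hGZK hCassels (ramifiedCMStrictTorsionAt_of_GZK hGZK W p)
    (ramifiedCMStrictControlAt_holds W p) h3 hF (isIsogenous_of_isFrame hF) hr hκ γ hP hgen htors hdiv
    hndiv hP' hgen' htors' hdiv' hndiv'

end Summit.BirchSwinnertonDyer.BirchSwinnertonDyer.Theorems.RamifiedSevenEllipticUnits

end
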